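import Literature.Geometry.Symplectic.CanonicalClassSqAndAdjunctionReduction
import Literature.Geometry.Symplectic.HirzebruchSignatureAlmostComplexFour
import Literature.AlgebraicTopology.CharacteristicClasses.Complexification
import Literature.Topology.FourManifolds.BordismFourProofs
import Literature.Topology.FourManifolds.LatticeFormsCharacteristic
import Summits.SmoothPoincare4.SmoothPoincare4.Theses.SymplecticOrigami

/-!
# Sketch — crux `SymplecticChernPackage` (stmt-SmoothPoincare4-16627), crux-ideate round 1, ideator 1

First lemmas of the two idea cards, typed over existing declarations (nothing here is proposed to
the tree; `def … : Prop` are statements, the `theorem`s are the cheap wirings, proved).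

* card `bordism-transfer-p1`: `firstPontryaginNumber_eq_of_isOrientedBordant` (PB), the J-free apex
  `hirzebruch_signature_four`, (B2) `chernNumber_eq_pontryaginNumber`, and the two wirings
  `hirzebruch_signature_four_of_thom` ((B1) ⇐ S36 apex + PB + comparison family) and
  `h443_of_hirzebruch_of_B2` (the tree's hypothesis `h443` ⇐ (B1) + (B2)).
* card `triple-point-balancing`: `latticeBalancing` (the arithmetic that replaces Kirby's
  hypothesis `p₁ = σ = 0` in Lemma VI.1 / Cor. VI.3) and `balancing_endgame` (the last three lines).
-/

noncomputable section

namespace Summit.SmoothPoincare4.SmoothPoincare4.Cruxes.SymplecticChernPackage.Sketch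

open Literature.AlgebraicTopology.SingularHomology Literature.AlgebraicTopology.CharacteristicClasses
open Literature.Topology.FourManifolds Literature.Geometry.Symplectic
open scoped Manifold ContDiff

/-- Sanity: the crux IS the Literature named fact. -/
example : Summit.SmoothPoincare4.SmoothPoincare4.Theses.SymplecticOrigami.SymplecticChernPackage ↔
    canonicalClass_sq_and_adjunction_of_symplectic_four := Iff.rfl

/-- The first Pontryagin number `⟨p₁(TM), [M]_μ⟩` of a `ℤ`-oriented smooth 4-manifold, over the
tree's `tangentPontryaginClass` (Complexification.lean) and `kroneckerPairing`. -/
def pontryaginNumber (M : Type) [TopologicalSpace M] [ChartedSpace (EuclideanSpace ℝ (Fin 4)) M]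
    [IsManifold (𝓡 4) ∞ M] (μ : HomologicalOrientation ℤ M 4) : ℤ :=
  kroneckerPairing ℤ ℤ M 4
    (degCast ℤ (by norm_num : 4 * 1 = 4) (tangentPontryaginClass (𝓡 4) M 1)) μ.fundamentalClass

/-! ### Card `bordism-transfer-p1` -/

/-- **(PB) First lemma of card 1: Pontryagin numbers are oriented-bordism invariants** (Thom's
dual of the tree's PROVED `signature_eq_of_isOrientedBordant_holds`; proof plan: `inl^* TW ≅ TM ⊕ ε`
along the boundary (collar), `p₁(TM ⊕ ε) = p₁(TM)` (Whitney for `chernClassZ` of the complexification),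
and `⟨x|_∂W, ∂w⟩ = ⟨x, i_* ∂w⟩ = 0` by exactness of the pair sequence of `(W, ∂W)`). -/
def firstPontryaginNumber_eq_of_isOrientedBordant : Prop :=
  ∀ {M N : Type} [TopologicalSpace M] [T2Space M] [SecondCountableTopology M]
    [ChartedSpace (EuclideanSpace ℝ (Fin 4)) M] [CompactSpace M] [IsManifold (𝓡 4) ∞ M]
    [TopologicalSpace N] [T2Space N] [SecondCountableTopology N]
    [ChartedSpace (EuclideanSpace ℝ (Fin 4)) N] [CompactSpace N] [IsManifold (𝓡 4) ∞ N]
    (μ : HomologicalOrientation ℤ M 4) (ν : HomologicalOrientation ℤ N 4),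
    IsOrientedBordant 4 μ ν → pontryaginNumber M μ = pontryaginNumber N ν

/-- **The J-free apex: Hirzebruch's signature theorem in dimension 4**, `⟨p₁, [M]_μ⟩ = 3 σ(M, μ)`
for every closed smooth `ℤ`-oriented 4-manifold (Kirby 1989 Thm IX.1; Hirzebruch 1966 Thm 8.2.2). -/
def hirzebruch_signature_four : Prop :=
  ∀ (M : Type) [TopologicalSpace M] [T2Space M] [SecondCountableTopology M]
    [ChartedSpace (EuclideanSpace ℝ (Fin 4)) M] [CompactSpace M] [IsManifold (𝓡 4) ∞ M]
    (μ : HomologicalOrientation ℤ M 4), pontryaginNumber M μ = 3 * μ.signature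

/-- **(B2)** `⟨c₁² − 2 c₂, [N]_μ⟩ = ⟨p₁, [N]_μ⟩` for an almost complex 4-manifold (Hirzebruch 1966
Thm 4.5.1: `TN ⊗ ℂ ≅ T_J ⊕ T̄_J`, `c(T̄) = 1 − c₁ + c₂`; Milnor–Stasheff Cor. 15.5). -/
def chernNumber_eq_pontryaginNumber : Prop :=
  ∀ (N : Type) [TopologicalSpace N] [T2Space N] [SecondCountableTopology N]
    [CompactSpace N] [ConnectedSpace N] [ChartedSpace (EuclideanSpace ℝ (Fin 4)) N]
    [IsManifold (𝓡 4) ∞ N] (J : AlmostComplexStructure (𝓡 4) ∞ N)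
    (μ : HomologicalOrientation ℤ N 4),
    cupPairing μ two_add_two_eq_four J.firstChernClass J.firstChernClass -
        2 * kroneckerPairing ℤ ℤ N 4 (degCast ℤ (by norm_num : 2 * 2 = 4) (J.chernClass 2))
          μ.fundamentalClass = pontryaginNumber N μ

/-- **Comparison family** (normalisation): for every integer `s` some closed smooth `ℤ`-oriented
4-manifold has `σ = s` and `p₁ = 3 s` (disjoint unions / connected sums of `±ℂℙ²`; `p₁[ℂℙ²] = 3`
from (Adj) on the line + (B2) + (B3) on the tree's `ComplexProjectivePlane`, or from `Tℂℙ² ⊕ ℂ ≅ 3 𝒪(1)`). -/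
def comparisonFamily : Prop :=
  ∀ s : ℤ, ∃ (N : Type) (_ : TopologicalSpace N) (_ : T2Space N) (_ : SecondCountableTopology N)
    (_ : ChartedSpace (EuclideanSpace ℝ (Fin 4)) N) (_ : CompactSpace N) (_ : IsManifold (𝓡 4) ∞ N)
    (ν : HomologicalOrientation ℤ N 4), ν.signature = s ∧ pontryaginNumber N ν = 3 * s

/-- **Wiring of card 1: (B1) hangs off the EXISTING apex of spc4.S36.**  Thom injectivity
(`isOrientedBordant_of_signature_eq`, Thom IV.13 / Kirby IX.2) + (PB) + the comparison family give
Hirzebruch's theorem in dimension 4.  PROVED (three lines). -/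
theorem hirzebruch_signature_four_of_thom (hT : isOrientedBordant_of_signature_eq.{0})
    (hPB : firstPontryaginNumber_eq_of_isOrientedBordant) (hC : comparisonFamily) :
    hirzebruch_signature_four := by
  intro M _ _ _ _ _ _ μ
  obtain ⟨N, _, _, _, _, _, _, ν, hσ, hp⟩ := hC μ.signature
  have hb : IsOrientedBordant 4 μ ν := hT μ ν hσ.symm
  rw [hPB μ ν hb, hp]

/-- **Wiring of card 1, second half: the tree's hypothesis `h443` (`3σ = ⟨c₁² − 2c₂, [N]⟩`, the
form consumed by `hirzebruchWu_of_signatureFormula_of_topChernNumber`) from the J-free apex and (B2).**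
PROVED. -/
theorem h443_of_hirzebruch_of_B2 (hH : hirzebruch_signature_four) (hB2 : chernNumber_eq_pontryaginNumber) :
    ∀ (N : Type) [TopologicalSpace N] [T2Space N] [SecondCountableTopology N]
      [CompactSpace N] [ConnectedSpace N] [ChartedSpace (EuclideanSpace ℝ (Fin 4)) N]
      [IsManifold (𝓡 4) ∞ N] (J : AlmostComplexStructure (𝓡 4) ∞ N)
      (μ : HomologicalOrientation ℤ N 4),
      3 * μ.signature =
        cupPairing μ two_add_two_eq_four J.firstChernClass J.firstChernClass -
          2 * kroneckerPairing ℤ ℤ N 4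
            (degCast ℤ (by norm_num : 2 * 2 = 4) (J.chernClass 2)) μ.fundamentalClass := by
  intro N _ _ _ _ _ _ _ J μ
  rw [hB2 N J μ, hH N μ]

/-- … hence the crux's residual (B) in the tree's own reduction chain: from the J-free apex, (B2),
the top Chern number (B3) and (Adj), the Literature fact (= the crux) follows.  PROVED (wiring only). -/
theorem crux_of_hirzebruch_of_B2_of_B3_of_adj (hH : hirzebruch_signature_four)
    (hB2 : chernNumber_eq_pontryaginNumber)
    (hc₂ : ∀ (N : Type) [TopologicalSpace N] [T2Space N] [SecondCountableTopology N]
      [CompactSpace N] [ConnectedSpace N] [ChartedSpace (EuclideanSpace ℝ (Fin 4)) N]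
      [IsManifold (𝓡 4) ∞ N] (J : AlmostComplexStructure (𝓡 4) ∞ N)
      (μ : HomologicalOrientation ℤ N 4), μ.IsComplexOrientationOf J →
      kroneckerPairing ℤ ℤ N 4
          (degCast ℤ (by norm_num : 2 * 2 = 4) (J.chernClass 2)) μ.fundamentalClass = relEuler ℤ ℤ N ∅)
    (hAdj : ∀ (N : Type) [TopologicalSpace N] [T2Space N] [SecondCountableTopology N]
      [CompactSpace N] [ConnectedSpace N] [ChartedSpace (EuclideanSpace ℝ (Fin 4)) N]
      [IsManifold (𝓡 4) ∞ N] (s : Literature.Geometry.Kaehler.MForm (𝓡 4) N ℝ 2)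
      (hs : Literature.Geometry.Kaehler.IsSmoothForm s) (hcl : Literature.Geometry.Kaehler.IsClosedForm s)
      (_ : ∀ x (v : TangentSpace (𝓡 4) x), v ≠ 0 → ∃ w : TangentSpace (𝓡 4) x, s x ![v, w] ≠ 0)
      (μ : HomologicalOrientation ℤ N 4), μ.IsSymplecticOrientationOf s hs hcl →
      ∀ (J : AlmostComplexStructure (𝓡 4) ∞ N), J.IsCompatibleWith s →
      ∀ (S : Type) [TopologicalSpace S] [CompactSpace S] [ConnectedSpace S]
        [ChartedSpace (EuclideanSpace ℝ (Fin 2)) S] [IsManifold (𝓡 2) ∞ S] (b : S → N)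
        (hb : Manifold.IsSmoothEmbedding (𝓡 2) (𝓡 4) ∞ b),
        (∀ y (v : TangentSpace (𝓡 2) y), v ≠ 0 → ∃ w : TangentSpace (𝓡 2) y,
          s (b y) ![mfderiv (𝓡 2) (𝓡 4) b y v, mfderiv (𝓡 2) (𝓡 4) b y w] ≠ 0) →
        ∃ μS : HomologicalOrientation ℤ S 2,
          ∀ σ : ↥(singularCohomology ℤ ℤ N 2),
            poincareDualityMap μ two_add_two_eq_four σ =
              singularHomology.map ℤ ℤ ⟨b, hb.isEmbedding.continuous⟩ 2 μS.fundamentalClass →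
            (Module.finrank ℤ ↥(singularHomology ℤ ℤ S 1) : ℤ) - 2 =
              cupPairing μ two_add_two_eq_four σ σ +
                cupPairing μ two_add_two_eq_four J.canonicalClass σ) :
    Summit.SmoothPoincare4.SmoothPoincare4.Theses.SymplecticOrigami.SymplecticChernPackage :=
  canonicalClass_sq_and_adjunction_of_symplectic_four_of_signatureFormula_of_topChernNumber_of_adjunction
    (h443_of_hirzebruch_of_B2 hH hB2) hc₂ hAdj

/-! ### Card `triple-point-balancing` -/

/-- **First lemma of card 2 (lattice balancing).**  For a symmetric unimodular lattice `Q` (think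
`Q = Q_{M₁}`, `M₁` simply connected, `σ(Q) = s`) and ANY integer `p` (think `p = p₁[M]`), there are
`a, b` and a characteristic vector of `Q⊕Q⊕Q⊕Q ⊕ a⟨1⟩ ⊕ b⟨−1⟩` — i.e. `(w,w,w,w; u; v)` with `w`
characteristic and all `uᵢ, vⱼ` odd — whose square is `−(4p + 3(a − b)) = −p₁(#⁴M₁ # aℂℙ² # bℂℙ̄²)`.
This is exactly the input of Kirby's Lemma VI.1 (immersion `↬ ℝ⁶` iff a characteristic `c` with
`c² = −p₁`), with NO hypothesis on `p` or `s` (Kirby's Cor. VI.3 needs `p₁ = σ = 0`).  Elementary: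
choose the parity of `a − b` and `uᵢ, vⱼ ∈ {1, 3}`. -/
def latticeBalancing : Prop :=
  ∀ {V : Type} [AddCommGroup V] [Module ℤ V] [Module.Finite ℤ V] [Module.Free ℤ V]
    (Q : LinearMap.BilinForm ℤ V), Q.IsSymm → Q.IsUnimodular → ∀ p : ℤ,
    ∃ (a b : ℕ) (w : V) (u : Fin a → ℤ) (v : Fin b → ℤ),
      Q.IsCharacteristic w ∧ (∀ i, Odd (u i)) ∧ (∀ j, Odd (v j)) ∧
      4 * Q w w + (∑ i, u i ^ 2) - (∑ j, v j ^ 2) = -(4 * p + 3 * ((a : ℤ) - b))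

/-- **Endgame of card 2** (the only place numbers are compared).  With `s = σ(M)`, `p = p₁[M]`,
`X = #⁴M₁ # aℂℙ² # bℂℙ̄²` immersed in `ℝ⁶` with algebraic triple-point number `t₀`:
Herbert–Kirby VI.5 gives `−p₁(X) = 3 t₀`, i.e. `-(4p + 3(a-b)) = 3 t₀`; the balanced union
`Y = 2X ⊔ |t₀|·X'` (`X' = ℂℙ² # 3ℂℙ̄²` or its reverse, `t(X') = −2·sign t₀`, `σ(X') = 2·sign t₀`)
has `t(Y) = 0`, hence bounds (Kirby VIII L5, L6, Thm 3), hence `σ(Y) = 0`: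
`2(4s + (a − b)) + 2 t₀ = 0`.  Conclusion: `p = 3 s`.  PROVED (`omega`). -/
theorem balancing_endgame (s p t₀ : ℤ) (a b : ℕ)
    (hHerbert : -(4 * p + 3 * ((a : ℤ) - b)) = 3 * t₀)
    (hSignatureY : 2 * (4 * s + ((a : ℤ) - b)) + 2 * t₀ = 0) :
    p = 3 * s := by
  omega

/-- The model immersion's lattice datum: in `⟨1⟩ ⊕ 3⟨−1⟩ = Q(ℂℙ² # 3ℂℙ̄²)` the vector
`c = (3; 1, 1, 1)` (all coordinates odd, hence characteristic) has `c² = 6 = −p₁(ℂℙ² # 3ℂℙ̄²)`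
(`p₁ = 3 − 9`), so Kirby VI.1 immerses `ℂℙ² # 3ℂℙ̄²` in `ℝ⁶` with `t = −p₁/3 = 2`, `σ = −2`. -/
theorem model_square : (3 : ℤ) ^ 2 - 1 ^ 2 - 1 ^ 2 - 1 ^ 2 = 6 ∧ (3 : ℤ) - 3 * 3 = -6 ∧ (-(-6 : ℤ)) / 3 = 2 := by
  norm_num

end Summit.SmoothPoincare4.SmoothPoincare4.Cruxes.SymplecticChernPackage.Sketch

end
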